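import Mathlib
import Summits.Ventures.PercRepro2.TwoHullMasterPathCover

/-!
# The canonical cube cover of a path, II: the key of a word and the cover (blind cell PercRepro2,
night-4 g40, 2026-08-29; proofs/NIGHT4-G40.md §12)

Every non-constant word on the path is a key word or a sentinel word (`keyWord_or_sentWord`: the
key is the LAST colour change among all edges but the last, `changes`), key words of different
keys and sentinel words are distinct (`keyWord_disj`, `keyWord_ne_sentWord`), so the blocks of
TwoHullMasterPathCover.lean partition `U`: **`cubeCover_path`** — the cube-cover conjecture on
every path — and `twoHullMaster_path_of_cover`, a second proof of g39's `twoHullMaster_path`.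
-/

namespace Summit.Ventures.PercRepro2

namespace Blocks

open Hull LocRows Path2 Glue2

open scoped Classical

variable {V : Type*} {k : ℕ} {p : Fin (k + 3) → V}

/-! ## §3 The key of a word -/

/-- The set of colour changes among the first `k + 1` edges: the positions `i ≤ k − 1` with
`ζ i ≠ ζ (i + 1)`. -/
def changes (ζ : Config (Fin (k + 2))) : Finset (Fin k) :=
  Finset.univ.filter fun i => ζ (idx i) ≠ ζ (idxS i)

/-- A word with no change among the first `k + 1` edges is constant there. -/
lemma eq_zero_of_changes_empty {ζ : Config (Fin (k + 2))} (h : changes ζ = ∅) {j : Fin (k + 2)}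
    (hj : j.val ≤ k) : ζ j = ζ 0 := by
  have key : ∀ n : ℕ, n ≤ k → ∀ (hn : n < k + 2), ζ ⟨n, hn⟩ = ζ 0 := by
    intro n
    induction n with
    | zero => intro _ _; rfl
    | succ m ih =>
      intro hm hn
      have hmk : m < k := by omega
      have hnot : ζ (idx ⟨m, hmk⟩) = ζ (idxS ⟨m, hmk⟩) := by
        by_contra hne
        have : (⟨m, hmk⟩ : Fin k) ∈ changes ζ := by
          simp only [changes, Finset.mem_filter, Finset.mem_univ, true_and]
          exact hne
        rw [h] at this
        exact absurd this (Finset.notMem_empty _)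
      have e1 : ζ ⟨m + 1, hn⟩ = ζ (idxS ⟨m, hmk⟩) := rfl
      rw [e1, ← hnot]
      exact ih (by omega) (by omega)
  exact key j.val hj j.isLt

/-- After the last change the word is constant up to position `k`. -/
lemma eq_of_gt_max {ζ : Config (Fin (k + 2))} (hne : (changes ζ).Nonempty) {j : Fin (k + 2)}
    (hj : ((changes ζ).max' hne).val < j.val) (hjk : j.val ≤ k) :
    ζ j = ζ (idxS ((changes ζ).max' hne)) := by
  set i := (changes ζ).max' hne with hi
  have key : ∀ n : ℕ, i.val < n → n ≤ k → ∀ (hn : n < k + 2), ζ ⟨n, hn⟩ = ζ (idxS i) := by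
    intro n
    induction n with
    | zero => intro h; omega
    | succ m ih =>
      intro hm hmk hn
      rcases Nat.lt_or_ge i.val m with hlt | hge
      · have hmk' : m < k := by omega
        have hnot : ζ (idx ⟨m, hmk'⟩) = ζ (idxS ⟨m, hmk'⟩) := by
          by_contra hne'
          have hmem : (⟨m, hmk'⟩ : Fin k) ∈ changes ζ := by
            simp only [changes, Finset.mem_filter, Finset.mem_univ, true_and]
            exact hne'
          have := (changes ζ).le_max' _ hmem
          rw [← hi] at this
          have : m ≤ i.val := this
          omega
        have e1 : ζ ⟨m + 1, hn⟩ = ζ (idxS ⟨m, hmk'⟩) := rfl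
        rw [e1, ← hnot]
        exact ih hlt (by omega) (by omega)
      · have : m = i.val := by omega
        subst this
        rfl
  exact key j.val hj hjk j.isLt

/-- Every non-constant word is a key word or a sentinel word. -/
lemma keyWord_or_sentWord {ζ : Config (Fin (k + 2))} (hζ : ¬ IsConst ζ) :
    (∃ i ε, keyWord i ε = ζ) ∨ ∃ ε, sentWord ε = ζ := by
  by_cases hne : (changes ζ).Nonempty
  · left
    set i := (changes ζ).max' hne with hi
    have hmem : i ∈ changes ζ := (changes ζ).max'_mem hne
    simp only [changes, Finset.mem_filter, Finset.mem_univ, true_and] at hmem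
    refine ⟨i, fun x => match x with
      | Sum.inl j => ζ ⟨j.val, by omega⟩
      | Sum.inr false => ζ (idx i)
      | Sum.inr true => !ζ idxL, ?_⟩
    funext j
    by_cases h1 : j.val < i.val
    · rw [keyWord_lt _ h1]
    · by_cases h2 : j.val = i.val
      · rw [keyWord_eq _ h2]
        have hj : j = idx i := Fin.ext (by rw [idx_val]; exact h2)
        rw [hj]
      · by_cases h3 : j.val ≤ k
        · rw [keyWord_seg _ (by omega) h3]
          rw [eq_of_gt_max hne (by omega) h3]
          have hx : ζ (idx i) ≠ ζ (idxS i) := hmem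
          revert hx
          cases ζ (idx i) <;> cases ζ (idxS i) <;> simp
        · rw [keyWord_last _ (by omega)]
          have : j = idxL := Fin.ext (by rw [idxL_val]; omega)
          rw [this]
          simp
  · right
    rw [Finset.not_nonempty_iff_eq_empty] at hne
    refine ⟨fun _ => ζ 0, ?_⟩
    funext j
    by_cases hj : j.val ≤ k
    · rw [sentWord_le _ hj, eq_zero_of_changes_empty hne hj]
    · rw [sentWord_last _ (by omega)]
      have hjL : j = idxL := Fin.ext (by rw [idxL_val]; omega)
      rw [hjL]
      by_contra hcon
      apply hζ
      intro a b
      have hall : ∀ c : Fin (k + 2), ζ c = ζ 0 := by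
        intro c
        by_cases hc : c.val ≤ k
        · exact eq_zero_of_changes_empty hne hc
        · have : c = idxL := Fin.ext (by rw [idxL_val]; omega)
          rw [this]
          revert hcon
          cases ζ idxL <;> cases ζ 0 <;> simp
      rw [hall a, hall b]

/-- A key word is constant on `(i, k]`; a word that changes there has a different key. -/
lemma keyWord_disj {i i' : Fin k} {ε : keyCube i → Bool} {ε' : keyCube i' → Bool}
    (heq : keyWord i ε = keyWord i' ε') : i = i' := by
  by_contra hne
  rcases Nat.lt_or_gt_of_ne (fun h => hne (Fin.ext h)) with hlt | hgt
  · -- `i < i'`: at `i'` and `i' + 1` the word of key `i` is constant, that of key `i'` changes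
    have h1 := congrFun heq (idx i')
    have h2 := congrFun heq (idxS i')
    rw [keyWord_seg ε (by rw [idx_val]; omega) (by rw [idx_val]; omega), keyWord_eq ε' rfl] at h1
    rw [keyWord_seg ε (by rw [idxS_val]; omega) (by rw [idxS_val]; omega),
      keyWord_seg ε' (by rw [idxS_val]; omega) (by rw [idxS_val]; omega)] at h2
    rw [← h1] at h2
    cases ε (Sum.inr false) <;> simp at h2
  · have h1 := congrFun heq (idx i)
    have h2 := congrFun heq (idxS i)
    rw [keyWord_eq ε rfl, keyWord_seg ε' (by rw [idx_val]; omega) (by rw [idx_val]; omega)] at h1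
    rw [keyWord_seg ε (by rw [idxS_val]; omega) (by rw [idxS_val]; omega),
      keyWord_seg ε' (by rw [idxS_val]; omega) (by rw [idxS_val]; omega)] at h2
    rw [h1] at h2
    cases ε' (Sum.inr false) <;> simp at h2

/-- A key word is never a sentinel word. -/
lemma keyWord_ne_sentWord (i : Fin k) (ε : keyCube i → Bool) (ε' : Unit → Bool) :
    keyWord i ε ≠ sentWord ε' := by
  intro heq
  have h1 := congrFun heq (idx i)
  have h2 := congrFun heq (idxS i)
  rw [keyWord_eq ε rfl, sentWord_le ε' (by rw [idx_val]; omega)] at h1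
  rw [keyWord_seg ε (by rw [idxS_val]; omega) (by rw [idxS_val]; omega), sentWord_le ε' (by rw [idxS_val]; omega)] at h2
  rw [← h1] at h2
  cases ε (Sum.inr false) <;> simp at h2

/-! ## §4 The cover -/

/-- The coordinate types of the blocks. -/
def pathι : Fin k ⊕ Unit → Type
  | Sum.inl i => keyCube i
  | Sum.inr _ => Unit

/-- The blocks of the path. -/
def pathPt : (b : Fin k ⊕ Unit) → (pathι b → Bool) → Config (Fin (k + 2))
  | Sum.inl i => keyWord i
  | Sum.inr _ => sentWord

/-- The coordinate types are finite. -/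
@[reducible] def pathιFintype : ∀ b : Fin k ⊕ Unit, Fintype (pathι b)
  | Sum.inl i => inferInstanceAs (Fintype (Fin i.val ⊕ Bool))
  | Sum.inr _ => inferInstanceAs (Fintype Unit)

/-- **The canonical cube cover of a path.** -/
theorem cubeCover_path (hp : Function.Injective p) :
    CubeCover (pathEnds p) (p 0) (p (Fin.last (k + 2))) (pathPt (k := k)) := by
  refine ⟨?_, ?_, ?_⟩
  · intro b
    cases b with
    | inl i => exact cubeBlock_keyWord hp i
    | inr u => exact cubeBlock_sentWord hp
  · intro ζ hζ
    rw [last_notMem_hull_iff hp] at hζ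
    rcases keyWord_or_sentWord hζ with ⟨i, ε, he⟩ | ⟨ε, he⟩
    · exact ⟨Sum.inl i, ε, he⟩
    · exact ⟨Sum.inr (), ε, he⟩
  · intro b b' ε ε' heq
    cases b with
    | inl i =>
      cases b' with
      | inl i' => exact congrArg Sum.inl (keyWord_disj heq)
      | inr u => exact absurd heq (keyWord_ne_sentWord i ε ε')
    | inr u =>
      cases b' with
      | inl i' => exact absurd heq.symm (keyWord_ne_sentWord i' ε' ε)
      | inr u' => rfl

/-- **(MM) on every path from the cube cover** — a second proof of g39's `twoHullMaster_path`. -/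
theorem twoHullMaster_path_of_cover (hp : Function.Injective p) :
    TwoHullMaster (pathEnds p) (p 0) (p (Fin.last (k + 2))) := by
  haveI : ∀ b, Fintype (pathι (k := k) b) := pathιFintype
  exact twoHullMaster_of_cubeCover (cubeCover_path hp)

end Blocks

end Summit.Ventures.PercRepro2
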